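import Summits.BirchSwinnertonDyer.BirchSwinnertonDyer.Theorems.ByReductionTypeAtTwoAdditivePotGoodPrintFamily37a1
import Summits.BirchSwinnertonDyer.Rank1Residual.Additive.IntModelConductorCertificate
import Literature.NumberTheory.EllipticCurves.AgasheRibetStein2006.ManinConstantOptimalCurves
import Literature.NumberTheory.EllipticCurves.OrdinaryPrimesProofs
import HarnessLib

/-!
# K4 crux `AdditiveRankZeroAtTwo` (19098), child C3″ `AdditivePotGoodLowerHalfAtTwo` (22617): the `37a1`-family theorem
# (`printFamily37a1_lower`) with two of its displayed base data DISCHARGED — `N(37a1) = 37` IN THE KERNEL (the tree's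
# conductor certificate, no named fact) and the Manin constant `|c| = 1` BY PRINT (Agashe–Ribet–Stein 2006 Thm. 2.6)

Cell `bsd-2adic`, seat `bsd-2adic-k4-w2` GEN 5 (prover, explicit unit, no kit); `--supports stmt-BirchSwinnertonDyer-22617
--as helper`. HONEST FRAMING (D-0036/D-0054): audit-2 GEN 57's sheet on `h43` (evidence #11 on 22617) lists the three
displayed base data of `37a1` — `N = 37`, Manin `c = 1`, `val₂ x₄ = 1` — as «each one certificate/print-fact away» (§5 R2).
This file removes the first two: `conductorNorm_37a1` is a KERNEL numeral (the b2b-bsdres conductor certificate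
`IntModelCond.conductorNorm_mk_eq_of_certs_of_eq`: `Δ = 37`, non-split multiplicative at `37`, good at `2`, `3`; global
minimality re-certified by `RNCert.minCheck`), and `|c| = 1` follows from the optimal datum by the PUBLISHED named fact
`cremona_abs_maninConstant_eq_one_of_level_le` (ARS 2006 Thm. 2.6, `N ≤ 130000`). What stays displayed: the existence
of an optimal `Γ₀(37)`-parametrisation datum (`Dt`, `hopt`), the `χ₄`-datum of ANS §5.2 (`W4`, `x₄`, `val₂ x₄ = 1`), and
`x₁` (`L(37a1,1) = x₁Ω⁺`; `= 0`). Also recorded: `37a1` is GOOD at `2` in the kernel (`2 ∤ Δ_min = 37`), the input of the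
general wrapper `lowerHalf_twist_of_thm43`. Closes nothing at the `∀`-level; BSD is not proved by any of this.

References: [AgasheRibetStein2006] Thm. 2.6; [AdachiNomotoShii2026] Thm. 4.3 (ii), §5.2; [CremonaAlgorithms1997]
Table 1 (37a1: N = 37); [Silverman1994] IV.10–11 (conductor); [SilvermanAEC2009] VII.5.1.
-/

set_option autoImplicit false
set_option linter.dupNamespace false

noncomputable section

open scoped Classical

open WeierstrassCurve Literature.NumberTheory.EllipticCurves
  Literature.NumberTheory.EllipticCurves.Rank1Residual
  Literature.NumberTheory.EllipticCurves.Rank1Residual.Typed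
  Literature.NumberTheory.EllipticCurves.AdachiNomotoShii2026
  Literature.NumberTheory.EllipticCurves.ModularForms
  Literature.NumberTheory.EllipticCurves.CoatesLiTianZhai2015
  Literature.NumberTheory.EllipticCurves.AgasheRibetStein2006
  Summit.BirchSwinnertonDyer.Rank1Residual
  Summit.BirchSwinnertonDyer.Rank1Residual.X5.O1
  Summit.BirchSwinnertonDyer.BirchSwinnertonDyer.Rank2Observatory
  Summit.BirchSwinnertonDyer.BirchSwinnertonDyer.Rank2Observatory.RootNumber
  Summit.BirchSwinnertonDyer.BirchSwinnertonDyer.Rank2Observatory.Tate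
  Summit.BirchSwinnertonDyer.Rank1Residual.Additive.IntModelCond
  Summit.BirchSwinnertonDyer.BirchSwinnertonDyer.Rank1Residual.IntModel

namespace Summit.BirchSwinnertonDyer.BirchSwinnertonDyer.Theorems.AddPotGoodPrint

/-- **`N(37a1) = 37` as a KERNEL numeral** (`[0,0,1,−1,0]`: `Δ = 37`, non-split multiplicative at `37` — Euler
non-residue witness —, good at `2` and `3`; certificates `RNCert`/`RNCert3`/`LocalCert` checked by `decide +kernel`,
no named fact). [cite: CremonaAlgorithms1997, Table 1 (37a1)] [cite: Silverman1994, IV.10.2 and IV.11.1] -/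
theorem conductorNorm_37a1 : (⟨0, 0, 1, -1, 0⟩ : WeierstrassCurve ℚ).conductorNorm ℤ = 37 := by
  rw [show (⟨0, 0, 1, -1, 0⟩ : WeierstrassCurve ℚ) =
      ⟨((0 : ℤ) : ℚ), ((0 : ℤ) : ℚ), ((1 : ℤ) : ℚ), ((-1 : ℤ) : ℚ), ((0 : ℤ) : ℚ)⟩ by
    ext <;> norm_num]
  exact conductorNorm_mk_eq_of_certs_of_eq 0 0 1 (-1) 0
    (cm := ⟨0, 4, 3, [⟨37, 6, 1, 0, 0⟩]⟩) (c := ⟨0, 4, 3, 0, 1, 3, [⟨37, 6, 1, 0, 0⟩]⟩)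
    (l₂ := ⟨0, 0, 0, 0, 0, 0, 0⟩) (l₃ := ⟨0, 0, 0, 0, 0, 0, 0⟩)
    (by decide +kernel) (by decide +kernel) (by decide +kernel) (by decide +kernel) (by decide +kernel)

/-- `N(37a1) ≠ 0` (instance form needed by the parametrisation data). [cite: CremonaAlgorithms1997, Table 1 (37a1)] -/
theorem neZero_conductorNorm_37a1 : NeZero ((⟨0, 0, 1, -1, 0⟩ : WeierstrassCurve ℚ).conductorNorm ℤ) := by
  rw [conductorNorm_37a1]; exact ⟨by norm_num⟩

/-- **`37a1` is GOOD at `2`** in the kernel: `2 ∤ Δ_min = 37` (Silverman VII.5.1(a); the tree's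
`hasGoodReductionAtPrime_of_not_dvd`). [cite: SilvermanAEC2009, VII.5 Prop. 5.1(a)] -/
theorem hasGoodReductionAtPrime_two_37a1 [(⟨0, 0, 1, -1, 0⟩ : WeierstrassCurve ℚ).IsGloballyMinimal] :
    (⟨0, 0, 1, -1, 0⟩ : WeierstrassCurve ℚ).HasGoodReductionAtPrime 2 := by
  have hI : integralModelInt (⟨0, 0, 1, -1, 0⟩ : WeierstrassCurve ℚ) = (⟨0, 0, 1, -1, 0⟩ : WeierstrassCurve ℤ) :=
    integralModelInt_eq_of_map_eq _ (map_mk_int 0 0 1 (-1) 0)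
  refine hasGoodReductionAtPrime_of_not_dvd _ 2 ?_
  rw [minimalDiscriminantInt_eq hI]
  decide +kernel

/-- **The Manin hypothesis of the `37a1` theorem BY PRINT**: an optimal parametrisation datum `Dt` of `37a1` at level
`N(37a1) = 37 ≤ 130000` has `|c| = 1` (Agashe–Ribet–Stein 2006 Thm. 2.6 = named fact
`cremona_abs_maninConstant_eq_one_of_level_le`), i.e. `Dt.c.natAbs = 1`. [cite: AgasheRibetStein2006, Thm. 2.6 (p. 619)] -/
theorem natAbs_c_eq_one_37a1 (h26 : cremona_abs_maninConstant_eq_one_of_level_le)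
    [(⟨0, 0, 1, -1, 0⟩ : WeierstrassCurve ℚ).IsElliptic] [(⟨0, 0, 1, -1, 0⟩ : WeierstrassCurve ℚ).IsGloballyMinimal]
    [NeZero ((⟨0, 0, 1, -1, 0⟩ : WeierstrassCurve ℚ).conductorNorm ℤ)]
    (Dt : ModularParametrizationData (⟨0, 0, 1, -1, 0⟩ : WeierstrassCurve ℚ)
      ((⟨0, 0, 1, -1, 0⟩ : WeierstrassCurve ℚ).conductorNorm ℤ))
    (hopt : Zhai2021.IsOptimalDatum (⟨0, 0, 1, -1, 0⟩ : WeierstrassCurve ℚ) Dt) : Dt.c.natAbs = 1 := by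
  have h := h26 _ Dt hopt (by rw [conductorNorm_37a1]; norm_num)
  rw [ModularParametrizationData.maninConstant, Int.abs_eq_natAbs] at h
  exact_mod_cast h

/-- **C3″ BY PRINT on the `37a1` family — `N = 37` and Manin `|c| = 1` discharged.** As `printFamily37a1_lower`, with the
conductor hypothesis replaced by the kernel numeral `conductorNorm_37a1` and the Manin hypothesis by Agashe–Ribet–Stein
Thm. 2.6 (`h26`). Displayed: the optimal datum (`Dt`, `hopt`), `x₁`, and the `χ₄`-datum of ANS §5.2 (`W4`, `x₄`,
`val₂ x₄ = 1`). For every nonempty `Q ⊆ {q prime : q ≡ 1 (mod 4), q ≠ 37, a_q(37a1) odd}` and every global minimal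
`W ≅ 37a1^{(−∏Q)}`: `r_an(W) = 0 ∧ Addv W 2 ∧ 0 ≤ ord₂ j(W) ∧ ¬W.HasCM ∧ Irr W 2 ∧ MissingLowerBoundAt W 2`.
[cite: AdachiNomotoShii2026, Thm. 4.3 (ii), §1 Example, §5.2] [cite: AgasheRibetStein2006, Thm. 2.6] [cite: Miller2011LMS, Def. 1.1] -/
theorem printFamily37a1_lower_of_ARS (h43 : thm43_rectangular_n1) (h26 : cremona_abs_maninConstant_eq_one_of_level_le)
    (hmod : hasEntireLFunction_rat) (hGZK : rank_eq_analyticRank_of_analyticRank_le_one)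
    [(⟨0, 0, 1, -1, 0⟩ : WeierstrassCurve ℚ).IsElliptic] [(⟨0, 0, 1, -1, 0⟩ : WeierstrassCurve ℚ).IsGloballyMinimal]
    [NeZero ((⟨0, 0, 1, -1, 0⟩ : WeierstrassCurve ℚ).conductorNorm ℤ)]
    (Dt : ModularParametrizationData (⟨0, 0, 1, -1, 0⟩ : WeierstrassCurve ℚ)
      ((⟨0, 0, 1, -1, 0⟩ : WeierstrassCurve ℚ).conductorNorm ℤ))
    (hopt : Zhai2021.IsOptimalDatum (⟨0, 0, 1, -1, 0⟩ : WeierstrassCurve ℚ) Dt)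
    (x₁ : ℚ) (hx₁ : (⟨0, 0, 1, -1, 0⟩ : WeierstrassCurve ℚ).entireLFunction 1 =
      (x₁ : ℂ) * (leastRealPeriod (⟨0, 0, 1, -1, 0⟩ : WeierstrassCurve ℚ) : ℂ))
    (W4 : WeierstrassCurve ℚ) [W4.IsElliptic] [W4.IsGloballyMinimal]
    (hW4 : ∃ C : VariableChange ℚ, C • (⟨0, 0, 1, -1, 0⟩ : WeierstrassCurve ℚ).quadraticTwist (-1 : ℚ) = W4)
    (x₄ : ℚ) (hx₄ : IsAlgPart (⟨0, 0, 1, -1, 0⟩ : WeierstrassCurve ℚ) W4 (-1) x₄) (hv₄ : val₂ x₄ = 1)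
    (Q : Finset ℕ) (hQ : Q.Nonempty)
    (hS : ∀ q ∈ Q, q.Prime ∧ q % 4 = 1 ∧ q ≠ 37 ∧ ¬ (2 : ℤ) ∣ aq (⟨0, 0, 1, -1, 0⟩ : WeierstrassCurve ℚ) q)
    (W : WeierstrassCurve ℚ) [W.IsElliptic] [W.IsGloballyMinimal]
    (hW : ∃ C : VariableChange ℚ,
      C • (⟨0, 0, 1, -1, 0⟩ : WeierstrassCurve ℚ).quadraticTwist (-((∏ q ∈ Q, q : ℕ) : ℚ)) = W) :
    W.analyticRank = 0 ∧ Addv W 2 ∧ 0 ≤ padicValRat 2 W.j ∧ ¬ W.HasCM ∧ Irr W 2 ∧ MissingLowerBoundAt W 2 :=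
  printFamily37a1_lower h43 hmod hGZK conductorNorm_37a1 Dt hopt (natAbs_c_eq_one_37a1 h26 Dt hopt) x₁ hx₁ W4 hW4
    x₄ hx₄ hv₄ Q hQ hS W hW

end Summit.BirchSwinnertonDyer.BirchSwinnertonDyer.Theorems.AddPotGoodPrint

end
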